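import Mathlib
import HarnessLib
import Summits.Ventures.LatticeQCDFlow.Exactness.GaugeFTHMCLeapfrog
import Summits.Ventures.LatticeQCDFlow.Exactness.NCPLayerEquiv

/-!
# The FT-HMC configuration chain, as the engine runs it, satisfies DETAILED BALANCE (not only invariance) — the hypothesis of the cell's reversible-chain autocorrelation theorems

HONEST FRAMING: exact (Metropolis-corrected) sampling algorithms for lattice gauge theory;
figures of merit are autocorrelation/cost numbers at stated couplings and volumes; no
continuum-physics claim.

Venture `LatticeQCDFlow` (cell pub-lqcd), topic `Exactness`; FANOUT row 14 (`eng-flowhmc`, engine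
`latflow.fthmc`, family B).  NEW WORK of the cell; nothing is cited as a fact; no number.
`MomentumRefresh.hmc_config_exact` / `thmc_config_exact` and `GaugeFTHMCLeapfrog.*_exact` state
INVARIANCE of `e^{−S}·vol` under the configuration chain "refresh momenta → volume-preserving
involutive proposal → Metropolis → forget momenta (→ report through the map)".  The same chain is
in fact REVERSIBLE with respect to `e^{−S}·vol` (Mathlib's `Kernel.IsReversible`, detailed balance
on measurable rectangles): the skeleton is reversible (`InvolutiveMetropolis.involMH_isReversible`),
detailed balance survives refresh–update–forget (`MomentumRefresh.refreshUpdate_isReversible`)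
and reporting through a certified map (`TransformedKernel.thmc_isReversible`).  This file does the
assembly, down to the U(1) rung with Gaussian momenta and a member given as a list of certified
layers.  Why it matters for the row: the figure of merit is an integrated autocorrelation time,
and the cell's `τ_int` theorems for Markov chains (`Exactness/ReversibleTauIntFloor`,
`ReversibleAutocovMonotone`, `ReversibleOperatorL2`, …) are stated for REVERSIBLE kernels — which
the engine's chains therefore are, at every step size, trajectory length and force accuracy.

## Content

* `isReversible_smul` — detailed balance is insensitive to normalisation (`c • π`).
* **`hmc_config_isReversible`**, **`thmc_config_isReversible`** — the reversible twins of
  `hmc_config_exact` / `thmc_config_exact` (any phase space, any measurable `vol ⊗ volP`-preserving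
  involution; detailed balance needs no hypothesis on `Z_T`).
* **`gauge_hmc_leapfrog_config_isReversible`**, **`gauge_fthmc_leapfrog_config_isReversible`** —
  links in any measurable group with left-invariant `μ`, group drift `U ↦ e(p)·U` with
  `e(−p) = e(p)⁻¹`, ANY measurable force, leapfrog^n, flip, Metropolis (on the pulled-back
  Hamiltonian for FT-HMC), report.
* **`u1_hmc_leapfrog_gaussian_isReversible`**, **`u1_fthmc_leapfrog_gaussian_isReversible`**,
  **`u1_fthmc_leapfrog_gaussian_isReversible_foldr`** — the U(1) rung (`ι → U(1)` product Haar,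
  Lebesgue momenta, `T = Σ p²/2`, `V_i ← e^{icp_i}V_i`), through any certified member or list of
  certified layers.

NOT here: ergodicity / irreducibility (reversibility is detailed balance, not mixing); SU(N)
members; any number.
-/

noncomputable section

namespace Summit.Ventures.LatticeQCDFlow.Exactness

open Set Function MeasureTheory Filter
open ProbabilityTheory ProbabilityTheory.Kernel
open Literature.MathematicalPhysics.QuantumFieldTheory (haarProbability)
open scoped NNReal ENNReal Topology

/-! ## Normalisation bookkeeping -/

section Smul

variable {Ω : Type*} [MeasurableSpace Ω]

/-- Detailed balance for `π` gives detailed balance for `c • π`. -/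
theorem isReversible_smul {κ : Kernel Ω Ω} {π : Measure Ω} (h : IsReversible κ π) (c : ℝ≥0∞) :
    IsReversible κ (c • π) := by
  intro A B hA hB
  rw [Measure.restrict_smul, Measure.restrict_smul, lintegral_smul_measure,
    lintegral_smul_measure, h hA hB]

end Smul

/-! ## HMC and THMC configuration chains are reversible -/

section Config

variable {Ω P : Type*} [MeasurableSpace Ω] [MeasurableSpace P]
  {vol : Measure Ω} {volP : Measure P} [SFinite vol] [SFinite volP] {S : Ω → ℝ} {T : P → ℝ}
  {Φ : Ω × P → Ω × P} {hΦ : Measurable Φ}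

/-- **The HMC configuration update satisfies detailed balance.**  Target `e^{−S}·vol`; kinetic
term `T`, momentum law `Z_T⁻¹ e^{−T}·volP` (detailed balance needs no hypothesis on `Z_T`);
`Φ` ANY measurable `vol ⊗ volP`-preserving involution (integrator then momentum flip, any step
size).  Refresh → propose `Φ` → accept with `min(1, e^{−ΔH})` → forget is
`e^{−S}·vol`-reversible. -/
theorem hmc_config_isReversible (hS : Measurable S) (hT : Measurable T)
    (hinv : Function.Involutive Φ) (hvol : MeasurePreserving Φ (vol.prod volP) (vol.prod volP)) :
    IsReversible
      (refreshUpdate (involMH Φ hΦ fun z : Ω × P => S z.1 + T z.2)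
        ((volP.withDensity (fun π => ENNReal.ofReal (Real.exp (-T π))) Set.univ)⁻¹ •
          volP.withDensity fun π => ENNReal.ofReal (Real.exp (-T π))))
      (vol.withDensity fun u => ENNReal.ofReal (Real.exp (-S u))) := by
  set νT := volP.withDensity fun π => ENNReal.ofReal (Real.exp (-T π)) with hνT
  set Z := νT Set.univ with hZ
  have hH : Measurable fun z : Ω × P => S z.1 + T z.2 :=
    (hS.comp measurable_fst).add (hT.comp measurable_snd)
  have hrev := involMH_isReversible (vol := vol.prod volP) (hΦ := hΦ) hH hinv hvol
  rw [withDensity_exp_neg_add_prod vol volP hS hT] at hrev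
  have hprod : (vol.withDensity fun u => ENNReal.ofReal (Real.exp (-S u))).prod (Z⁻¹ • νT) =
      Z⁻¹ • (vol.withDensity fun u => ENNReal.ofReal (Real.exp (-S u))).prod νT :=
    Measure.prod_smul_right _
  refine refreshUpdate_isReversible ?_
  rw [hprod]
  exact isReversible_smul hrev _

/-- **THMC as the code runs it satisfies detailed balance.**  Field transformation `F` with
positive measurable Jacobian `J`; refresh, propose with ANY measurable `vol ⊗ volP`-preserving
involution for the modified Hamiltonian `(S∘F − log J) + T`, accept, forget, REPORT `U = F V`:
the configuration chain is `e^{−S}·vol`-reversible. -/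
theorem thmc_config_isReversible {F : Ω ≃ᵐ Ω} {J : Ω → ℝ} (hJ : ∀ v, 0 < J v)
    (hJm : Measurable J) (hF : HasJacobian vol F fun v => ENNReal.ofReal (J v))
    (hS : Measurable S) (hT : Measurable T) (hinv : Function.Involutive Φ)
    (hvol : MeasurePreserving Φ (vol.prod volP) (vol.prod volP)) :
    IsReversible
      (conjKernel
        (refreshUpdate (involMH Φ hΦ fun z : Ω × P => (S (F z.1) - Real.log (J z.1)) + T z.2)
          ((volP.withDensity (fun π => ENNReal.ofReal (Real.exp (-T π))) Set.univ)⁻¹ •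
            volP.withDensity fun π => ENNReal.ofReal (Real.exp (-T π))))
        F)
      (vol.withDensity fun u => ENNReal.ofReal (Real.exp (-S u))) := by
  have hSt : Measurable fun v => S (F v) - Real.log (J v) :=
    (hS.comp F.measurable).sub (Real.measurable_log.comp hJm)
  have h := hmc_config_isReversible (vol := vol) (volP := volP) (hΦ := hΦ)
    (S := fun v => S (F v) - Real.log (J v)) hSt hT hinv hvol
  exact thmc_isReversible hJ hF hS h

end Config

/-! ## The gauge-link engine: any group, left-invariant reference, group drift -/

section Gauge

variable {Q P : Type*}

/-- **Gauge-link HMC as the code runs it satisfies detailed balance** (hypotheses of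
`gauge_hmc_leapfrog_config_exact`). -/
theorem gauge_hmc_leapfrog_config_isReversible [Group Q] [MeasurableSpace Q] [MeasurableMul₂ Q]
    {μ : Measure Q} [μ.IsMulLeftInvariant] [SFinite μ] [AddCommGroup P] [MeasurableSpace P]
    [MeasurableNeg P] [MeasurableAdd₂ P] {ν : Measure P} [ν.IsNegInvariant]
    [ν.IsAddRightInvariant] [SFinite ν] {e : P → Q} (he : ∀ p, e (-p) = (e p)⁻¹)
    (hem : Measurable e) {g : Q → P} (hg : Measurable g) (n : ℕ)
    {S : Q → ℝ} (hS : Measurable S) {T : P → ℝ} (hT : Measurable T) :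
    IsReversible
      (refreshUpdate
        (involMH (⇑((flip : Equiv.Perm (Q × P)) * leapfrog (mulDrift e) g ^ n))
          (measurable_flip_leapfrog_pow (measurable_mulDrift hem) hg n)
          fun z : Q × P => S z.1 + T z.2)
        ((ν.withDensity (fun q => ENNReal.ofReal (Real.exp (-T q))) Set.univ)⁻¹ •
          ν.withDensity fun q => ENNReal.ofReal (Real.exp (-T q))))
      (μ.withDensity fun u => ENNReal.ofReal (Real.exp (-S u))) :=
  hmc_config_isReversible hS hT (involutive_gaugeLeapfrogProposal he g n)
    (measurePreserving_gaugeLeapfrogProposal hem hg n)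

/-- **Gauge-link FT-HMC as `latflow.fthmc` runs it satisfies detailed balance** (hypotheses of
`gauge_fthmc_leapfrog_config_exact`): the reported configuration kernel is `e^{−S}·μ`-reversible. -/
theorem gauge_fthmc_leapfrog_config_isReversible [Group Q] [MeasurableSpace Q] [MeasurableMul₂ Q]
    {μ : Measure Q} [μ.IsMulLeftInvariant] [SFinite μ] [AddCommGroup P] [MeasurableSpace P]
    [MeasurableNeg P] [MeasurableAdd₂ P] {ν : Measure P} [ν.IsNegInvariant]
    [ν.IsAddRightInvariant] [SFinite ν] {F : Q ≃ᵐ Q} {J : Q → ℝ} (hJ : ∀ v, 0 < J v)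
    (hJm : Measurable J) (hF : HasJacobian μ F fun v => ENNReal.ofReal (J v))
    {e : P → Q} (he : ∀ p, e (-p) = (e p)⁻¹) (hem : Measurable e) {g : Q → P}
    (hg : Measurable g) (n : ℕ) {S : Q → ℝ} (hS : Measurable S) {T : P → ℝ} (hT : Measurable T) :
    IsReversible
      (conjKernel
        (refreshUpdate
          (involMH (⇑((flip : Equiv.Perm (Q × P)) * leapfrog (mulDrift e) g ^ n))
            (measurable_flip_leapfrog_pow (measurable_mulDrift hem) hg n)
            fun z : Q × P => (S (F z.1) - Real.log (J z.1)) + T z.2)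
          ((ν.withDensity (fun q => ENNReal.ofReal (Real.exp (-T q))) Set.univ)⁻¹ •
            ν.withDensity fun q => ENNReal.ofReal (Real.exp (-T q))))
        F)
      (μ.withDensity fun u => ENNReal.ofReal (Real.exp (-S u))) :=
  thmc_config_isReversible hJ hJm hF hS hT (involutive_gaugeLeapfrogProposal he g n)
    (measurePreserving_gaugeLeapfrogProposal hem hg n)

end Gauge

/-! ## The U(1) rung: product Haar links, Lebesgue momenta, Gaussian kinetic term -/

section U1

variable {ι : Type*} [Fintype ι]

/-- **HMC on the U(1) rung as `latflow.core.hmc` runs it satisfies detailed balance** with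
respect to `e^{−S}·Haar^ι` (hypotheses of `u1_hmc_leapfrog_gaussian_exact`). -/
theorem u1_hmc_leapfrog_gaussian_isReversible {S : (ι → Circle) → ℝ} (hS : Measurable S) (c : ℝ)
    {g : (ι → Circle) → (ι → ℝ)} (hg : Measurable g) (n : ℕ) :
    IsReversible
      (refreshUpdate
        (involMH
          (⇑((flip : Equiv.Perm ((ι → Circle) × (ι → ℝ))) *
              leapfrog (mulDrift fun p : ι → ℝ => fun i => Circle.exp (c * p i)) g ^ n))
          (measurable_flip_leapfrog_pow (measurable_mulDrift (measurable_circleDrift c)) hg n)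
          fun z : (ι → Circle) × (ι → ℝ) => S z.1 + ∑ i, z.2 i ^ 2 / 2)
        ((((volume : Measure (ι → ℝ)).withDensity
              fun p => ENNReal.ofReal (Real.exp (-(∑ i, p i ^ 2 / 2)))) Set.univ)⁻¹ •
          (volume : Measure (ι → ℝ)).withDensity
            fun p => ENNReal.ofReal (Real.exp (-(∑ i, p i ^ 2 / 2)))))
      ((Measure.pi fun _ : ι => haarProbability Circle).withDensity
        fun U => ENNReal.ofReal (Real.exp (-S U))) := by
  haveI := isNegInvariant_volume_pi (Λ := ι)
  exact gauge_hmc_leapfrog_config_isReversible (μ := Measure.pi fun _ : ι => haarProbability Circle)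
    (ν := (volume : Measure (ι → ℝ))) (e := fun p : ι → ℝ => fun i => Circle.exp (c * p i))
    (g := g) (S := S) (T := fun p : ι → ℝ => ∑ i, p i ^ 2 / 2)
    (fun p => circleDrift_neg c p) (measurable_circleDrift c)
    hg n hS measurable_piGaussianKinetic

/-- **FT-HMC on the U(1) rung exactly as `latflow.fthmc` runs it satisfies detailed balance**
with respect to `e^{−S}·Haar^ι`, through any member `F` with positive measurable certified
Jacobian `J` (hypotheses of `u1_fthmc_leapfrog_gaussian_exact`). -/
theorem u1_fthmc_leapfrog_gaussian_isReversible
    {F : (ι → Circle) ≃ᵐ (ι → Circle)} {J : (ι → Circle) → ℝ} (hJ : ∀ V, 0 < J V)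
    (hJm : Measurable J)
    (hF : HasJacobian (Measure.pi fun _ : ι => haarProbability Circle) F
      fun V => ENNReal.ofReal (J V))
    {S : (ι → Circle) → ℝ} (hS : Measurable S) (c : ℝ) {g : (ι → Circle) → (ι → ℝ)}
    (hg : Measurable g) (n : ℕ) :
    IsReversible
      (conjKernel
        (refreshUpdate
          (involMH
            (⇑((flip : Equiv.Perm ((ι → Circle) × (ι → ℝ))) *
                leapfrog (mulDrift fun p : ι → ℝ => fun i => Circle.exp (c * p i)) g ^ n))
            (measurable_flip_leapfrog_pow (measurable_mulDrift (measurable_circleDrift c)) hg n)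
            fun z : (ι → Circle) × (ι → ℝ) => (S (F z.1) - Real.log (J z.1)) + ∑ i, z.2 i ^ 2 / 2)
          ((((volume : Measure (ι → ℝ)).withDensity
                fun p => ENNReal.ofReal (Real.exp (-(∑ i, p i ^ 2 / 2)))) Set.univ)⁻¹ •
            (volume : Measure (ι → ℝ)).withDensity
              fun p => ENNReal.ofReal (Real.exp (-(∑ i, p i ^ 2 / 2)))))
        F)
      ((Measure.pi fun _ : ι => haarProbability Circle).withDensity
        fun U => ENNReal.ofReal (Real.exp (-S U))) := by
  haveI := isNegInvariant_volume_pi (Λ := ι)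
  exact gauge_fthmc_leapfrog_config_isReversible
    (μ := Measure.pi fun _ : ι => haarProbability Circle)
    (ν := (volume : Measure (ι → ℝ))) (F := F) (J := J)
    (e := fun p : ι → ℝ => fun i => Circle.exp (c * p i)) (g := g) (S := S)
    (T := fun p : ι → ℝ => ∑ i, p i ^ 2 / 2) hJ hJm hF (fun p => circleDrift_neg c p)
    (measurable_circleDrift c) hg n hS measurable_piGaussianKinetic

/-- **FT-HMC on the U(1) rung through a member given as a LIST of certified layers satisfies
detailed balance** (hypotheses of `u1_fthmc_leapfrog_gaussian_exact_foldr`). -/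
theorem u1_fthmc_leapfrog_gaussian_isReversible_foldr
    (layers : List (((ι → Circle) ≃ᵐ (ι → Circle)) × ((ι → Circle) → ℝ)))
    (hpos : ∀ L ∈ layers, ∀ V, 0 < L.2 V) (hmeas : ∀ L ∈ layers, Measurable L.2)
    (hjac : ∀ L ∈ layers,
      HasJacobian (Measure.pi fun _ : ι => haarProbability Circle) L.1
        fun V => ENNReal.ofReal (L.2 V))
    {S : (ι → Circle) → ℝ} (hS : Measurable S) (c : ℝ) {g : (ι → Circle) → (ι → ℝ)}
    (hg : Measurable g) (n : ℕ) :
    IsReversible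
      (conjKernel
        (refreshUpdate
          (involMH
            (⇑((flip : Equiv.Perm ((ι → Circle) × (ι → ℝ))) *
                leapfrog (mulDrift fun q : ι → ℝ => fun i => Circle.exp (c * q i)) g ^ n))
            (measurable_flip_leapfrog_pow (measurable_mulDrift (measurable_circleDrift c)) hg n)
            fun z : (ι → Circle) × (ι → ℝ) =>
              (S (layers.foldr (fun L (G : (ι → Circle) ≃ᵐ (ι → Circle)) => L.1.trans G)
                  (MeasurableEquiv.refl (ι → Circle)) z.1) -
                Real.log (layers.foldr (fun L K => fun V => L.2 V * K (L.1 V))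
                  (fun _ => (1 : ℝ)) z.1)) +
                ∑ i, z.2 i ^ 2 / 2)
          ((((volume : Measure (ι → ℝ)).withDensity
                fun q => ENNReal.ofReal (Real.exp (-(∑ i, q i ^ 2 / 2)))) Set.univ)⁻¹ •
            (volume : Measure (ι → ℝ)).withDensity
              fun q => ENNReal.ofReal (Real.exp (-(∑ i, q i ^ 2 / 2)))))
        (layers.foldr (fun L (G : (ι → Circle) ≃ᵐ (ι → Circle)) => L.1.trans G)
          (MeasurableEquiv.refl (ι → Circle))))
      ((Measure.pi fun _ : ι => haarProbability Circle).withDensity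
        fun U => ENNReal.ofReal (Real.exp (-S U))) := by
  obtain ⟨h0, hm, hJ⟩ := hasJacobian_foldr_trans layers hpos hmeas hjac
  exact u1_fthmc_leapfrog_gaussian_isReversible h0 hm hJ hS c hg n

end U1

end Summit.Ventures.LatticeQCDFlow.Exactness
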